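import Summits.QuantumFields.BalabanUV.Beta.D1BFx.MomentTransferDefect
import Summits.QuantumFields.BalabanUV.Beta.D1BFx.AssemblySlots
import Summits.QuantumFields.BalabanUV.Beta.D1BFx.GhostSqrtLegPins
import Summits.QuantumFields.BalabanUV.Beta.D1BFx.RestKernelWords

/-!
# `BalabanUV.Beta.D1BFx.GhostPinnedTransfer` — road «BF-x» for binder row D1, slot (K), chain step (S-GH) ∕ rest member RK-ΔGH, «ΔGHOST-TRANSFER»:
# THE (K7) LINE OF THE PINNED GHOST KERNEL `PghQ n a x₀ cK 0` (NO Ward rows) AND THE (1.22)-MOMENT OF `ΔGH` —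
# `secondMoment (PghQ(x₀,cK,0) − PghQ(ray c)) = Σ_b n⁻⁴·fullSum (n⁻⁸·w_μw_ν·(baseKer (fine pinned) − baseKer (fine ray))) + rowDefect n (fine pinned)`

HONEST DEPENDENCY (page 1, mandatory): continuum YM on T⁴ ⇐ BetaPertH ∧ nine spine estimates (0/9 proved); BetaPertH ⇐ (D1) ∧ (D4) ∧
CAP+tail; G-an2-4 gates asym, D1 and NE2/3/4.  HONEST FRAMING (cell contract, verbatim): «discharging `BetaPertH` makes Bałaban's UV
stability UNCONDITIONAL — a real constructive-QFT result; it is NOT the continuum limit and NOT the Clay problem.»  THIS MODULE DISCHARGES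
NOTHING of the wall: [folklore] bookkeeping composed BY NAME from the owner's (K7) TRANSFER-Δ
(`MomentTransferDefect.secondMoment_TOfGh_eq_avg_fullSum_add_rowDefect`, Ward-free), the owner's slot (F) of the ray kernel
(`AssemblySlots.hF_PghQ_ray`, Ward rows a THEOREM on the ray), leaf-02-g2's `GhostKernelComplete` (`PghQ`, `fineHessGhQ`, `absMoment₂_PghQ`,
`biLoc_WghAt_ctr`), leaf-04-g2's `GhostKernelRooted.biLoc_SghAt_ctr`, leaf-04-g17's pins `GhostSqrtLegPins.SghAt_cQ_zero` ∕ `WghAt_cQ_zero`, the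
fine sockets `GhostStencil.ghCur_translate` ∕ `GhostStencilReflection.ghX_translate`, and the owner's `Assembly.fullSum_sub'` ∕ `exists_tendsto_psum_weight_mul`.
No definition, no `def … : Prop`, nothing cited, 0 sorry.  `PghQ` is the road's CHECK-N0 MODEL, NOT claimed to be Bałaban's kernel.  0 root-level
binders discharged (hW ∕ hR-sockets ∕ hSX-socket ∕ D1Tel ∕ D1Rep = 0); NOT (K), NOT D1, NOT `BetaPertH`, NOT continuum, NOT Clay.

ABSOLUTE RULE (cell charter, verbatim): «No internally-minted statement may enter as a cited fact. Every hypothesis is either kernel-proved in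
this package or a verbatim quotation of a PUBLISHED theorem with page reference. The manuscript(s) under audit are NOT citable for their own
disputed steps — they are the thing under adjudication; programme-internal (2001/route/tribunal) claims are never citable.»

WHY (owner d1-p2 ruling ρ-g15-4 «ΔGHOST-AS-REST» + this lineage's located sizing note F-d1leaf01-g20-3 «ΔGH-DEFECT», journal
[D1LEAF01-G20-W3]).  (S-GH) of record pins the ghost slot's one-leg main term at `2·PghQ n a (−1) n² 0` (`GhostSqrtLegPins`, p311297): the
stencil `n²•ghCur` is KINETIC-ONLY against the leg `Ggh n a` (`Ggh⁻¹ = n²Δ + (a∕n⁴)·S_Q`), so the pinned fine kernel's Ward rows do NOT vanish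
and the A4∕K-R5 transfer of the END (`GhostKernelComplete.bondSecondMoment_PghQ_ray_eq_avgM2`, Ward rows a theorem ON THE RAY
`(x₀, cK, cQ) = (−c, c·n², c·a)` only) does not apply to it.  The END keeps its ghost letters on the ray; the difference
`ΔGH := 2·(PghQ(−1,n²,0) − PghQ(−1,n²,a))` joins the rest kernels (ρ-g15-4).  Its (1.22)-moment is NOT «the END's per-cell rows with the sign
flipped» alone: by the owner's Ward-free (K7) line the pinned kernel carries a ROW DEFECT.  THIS FILE types exactly that, and nothing more:
* §1 [folklore] the fine sockets of the pinned pair AT EVERY FINE TRANSLATION (`SghAt_cQ_zero_translate`, `WghAt_cQ_zero_translate` — the rooted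
  averaging stencils `qAntiAt`∕`qSqAt`, block-covariant only, are absent at `cQ = 0`), and **`secondMoment_PghQ_cQ_zero_eq`**: the (K7) line
  `secondMoment (PghQ n a x₀ cK 0) μ ν = Σ_b n⁻⁴·fullSum (w ↦ n⁻⁸·w_μw_ν·baseKer (fineHessGhQ n a x₀ cK 0 μ ν) b w) + rowDefect n (fineHessGhQ n a x₀ cK 0) μ ν`
  (`0 < a`; NO parity, NO Ward rows, every `x₀ cK`).
* §2 [folklore] **`secondMoment_PghQ_cQ_zero_sub_ray_eq`** (`Odd n`, `0 < a`, every `c x₀ cK`): the (1.22)-moment of the pointwise difference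
  `PghQ(x₀,cK,0) − PghQ(−c, c·n², c·a)` = the cells of the DIFFERENCE of the two fine kernels + the pinned kernel's row defect (the ray kernel has
  none: `AssemblySlots.hF_PghQ_ray`); **`secondMoment_deltaGH_eq`**: the instance of record `(x₀, cK, c) = (−1, n², 1)` with the weight `2` —
  `secondMoment ΔGH μ ν = 2·(cells of (fine pinned − fine ray)) + 2·rowDefect n (fineHessGhQ n a (−1) n² 0) μ ν`.
* §3 [folklore] `absMoment₂_const_mul_sub`; [our object] **`absMoment₂_deltaGH`**: the `hMR` row of the rest member `uΔGH` (kernel `ω·ΔGH`, any weight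
  `ω` — the END's `ωgh n`) from `absMoment₂_PghQ` ×2 — the one line of this file ON the (K) row's path (owner ruling ρ-g16-2 (2): «wire the member
  `uΔGH` into `Rk` … `hMR` by `absMoment₂_PghQ` ×2, `hRu` from FILE 5»).
READING AFTER OWNER RULING ρ-g16-2 (journal [D1P2-G16-RULING-2]): (Δ3) is ruled «ΔGH DIRECT» — `Ru(ΔGH) := 0`, `CU′(ΔGH)` := a direct n-uniform
(1.22)-moment envelope of the four cQ-sector one-leg words (leaf-04's «RK-GH-UNIT» FILE 5 «ΔGH-UNIT»); NO transfer, NO cells, NO defect on the (K) row's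
path.  Hence §1–§2 are NOT on the (K) row's path after ρ-g16-2; they are KEPT AS THE CELLS∕DEFECT READING — the located record (F-d1leaf01-g20-3,
accepted by ρ-g16-2 (1)) of why `ΔGH` is NOT «the END's cQ-cells with the sign flipped»: the pinned kernel carries the row defect
`rowDefect n (fineHessGhQ n a (−1) n² 0)`, which nobody needs to bound under «ΔGH DIRECT».  (Δ2) «ΔGHOST-CELLS» is withdrawn as a task.
WHAT THIS FILE DOES NOT DO: the word split of the cells term, any bound on the defect, the `hRu` envelope (FILE 5), anything about Bałaban's (1.22)
coefficients.
Unit `b2b-balaban-beta-d1-formalise-leaf-01` (gen 20), D1 formalisation swarm; journal INTENT [D1LEAF01-G20-INTENT-5].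
-/

noncomputable section

namespace Summit.QuantumFields.BalabanUV.Beta.D1BFx.GhostPinnedTransfer

open Finset Filter Topology
open scoped BigOperators
open Literature.MathematicalPhysics.QuantumFieldTheory.Balaban1983to89
open Literature.MathematicalPhysics.QuantumFieldTheory.Balaban1983to89.Beta
open WindowIdentification (fullSum)
open DyadicShell (Pt toReal)
open ExpKernelCalculus (Site MKer BiLoc shiftK)
open B12Sec2to5 (l1 l1_nonneg)
open DecimatedMomentSummable (AbsMoment₂)
open DressedMomentNormalisation (resSite)
open Summit.QuantumFields.BalabanUV.Beta.D1BFx.MomentTransferPeriodic (Ker₂ baseKer)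
open Summit.QuantumFields.BalabanUV.Beta.D1BFx.MomentTransferDefect (rowDefect secondMoment_TOfGh_eq_avg_fullSum_add_rowDefect)
open Summit.QuantumFields.BalabanUV.Beta.D1BFx.GhostStencil (ghCur ghCur_translate)
open Summit.QuantumFields.BalabanUV.Beta.D1BFx.GhostStencilReflection (ghX ghX_translate)
open Summit.QuantumFields.BalabanUV.Beta.D1BFx.GhostStencilRooted (SghAt)
open Summit.QuantumFields.BalabanUV.Beta.D1BFx.GhostStencilRootedReflection (ctrHalf)
open Summit.QuantumFields.BalabanUV.Beta.D1BFx.GhostAveragingSquare (WghAt)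
open Summit.QuantumFields.BalabanUV.Beta.D1BFx.GhostKernel (shiftK_smul)
open Summit.QuantumFields.BalabanUV.Beta.D1BFx.GhostKernelRooted (biLoc_SghAt_ctr)
open Summit.QuantumFields.BalabanUV.Beta.D1BFx.GhostKernelComplete (PghQ fineHessGhQ PghQ_eq fineHessGhQ_eq biLoc_WghAt_ctr absMoment₂_PghQ)
open Summit.QuantumFields.BalabanUV.Beta.D1BFx.GhostSqrtLegPins (SghAt_cQ_zero WghAt_cQ_zero)
open Summit.QuantumFields.BalabanUV.Beta.D1BFx.Assembly (exists_tendsto_psum_weight_mul exists_tendsto_psum_const_mul fullSum_sub')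
open Summit.QuantumFields.BalabanUV.Beta.D1BFx.AssemblySlots (hF_PghQ_ray absMoment₂_baseKer_fineHessGhQ)
open Summit.QuantumFields.BalabanUV.Beta.D1BFx.RestKernelWords (summable_moment_term)

/-! ## §1 The pinned pair's fine sockets at every translation; the (K7) line of `PghQ n a x₀ cK 0` -/

section Pinned

variable (n : ℕ) [NeZero n] (a : ℝ)

omit [NeZero n] in
/-- [folklore] At `cQ = 0` the rooted first-order ghost stencil is `cK • ghCur` (`GhostSqrtLegPins.SghAt_cQ_zero`), hence covariant under EVERY fine
translation (the rooted `qAntiAt` — block-covariant only — is absent). -/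
theorem SghAt_cQ_zero_translate (ρ : Site 4) (cK : ℝ) (κ' : Fin 4) (u v : Site 4) :
    SghAt ρ n cK 0 κ' (u + v) = shiftK (-v) (SghAt ρ n cK 0 κ' u) := by
  rw [SghAt_cQ_zero, SghAt_cQ_zero, ghCur_translate, shiftK_smul]

omit [NeZero n] in
/-- [folklore] At `cQ = 0` the completed two-bond table is the bond-diagonal contact `[κ = l ∧ v = v′]•(x₀·cK)•ghX κ v`
(`GhostSqrtLegPins.WghAt_cQ_zero`), hence jointly covariant under EVERY fine translation. -/
theorem WghAt_cQ_zero_translate (ρ : Site 4) (x₀ cK : ℝ) (κ' : Fin 4) (u : Site 4) (l' : Fin 4) (u' v : Site 4) :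
    WghAt ρ n x₀ cK 0 κ' (u + v) l' (u' + v) = shiftK (-v) (WghAt ρ n x₀ cK 0 κ' u l' u') := by
  rw [WghAt_cQ_zero, WghAt_cQ_zero]
  by_cases h : κ' = l' ∧ u = u'
  · rw [if_pos h, if_pos (⟨h.1, by rw [h.2]⟩ : κ' = l' ∧ u + v = u' + v), ghX_translate, shiftK_smul]
  · have h' : ¬(κ' = l' ∧ u + v = u' + v) := fun hh => h ⟨hh.1, add_right_cancel hh.2⟩
    rw [if_neg h, if_neg h']
    rfl

/-- [folklore] **THE (K7) LINE OF THE PINNED GHOST KERNEL** (`0 < a`; every generator ∕ kinetic weight `x₀ cK`; NO parity, NO Ward rows, NO table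
symmetry): `secondMoment (PghQ n a x₀ cK 0) μ ν = Σ_b n⁻⁴·fullSum (w ↦ n⁻⁸·w_μw_ν·baseKer (fineHessGhQ n a x₀ cK 0 μ ν) b w) + rowDefect n (fineHessGhQ n a x₀ cK 0) μ ν`
— the owner's Ward-free TRANSFER-Δ `MomentTransferDefect.secondMoment_TOfGh_eq_avg_fullSum_add_rowDefect` at the pinned pair (sockets
`biLoc_SghAt_ctr` ∕ `biLoc_WghAt_ctr` at rate `1∕n`, covariances §1).  The defect is NOT claimed to vanish: the pinned stencil `cK•ghCur` is
kinetic-only against `Ggh n a`, whose (W1) (`GhostKernelRooted` ∕ `ward₁_Ggh_rooted`) needs the full current.  NOT on the (K) row's path after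
owner ruling ρ-g16-2 («ΔGH DIRECT»); kept as the cells∕defect reading. -/
theorem secondMoment_PghQ_cQ_zero_eq (ha : 0 < a) (x₀ cK : ℝ) (μ ν : Fin 4) :
    B12Beta.secondMoment (PghQ n a x₀ cK 0) μ ν =
      (∑ b ∈ (univ : Finset (Fin 4 → Fin n)).image resSite, ((n : ℝ) ^ 4)⁻¹ *
        fullSum (fun w : Pt => ((n : ℝ) ^ 8)⁻¹ * (toReal w μ * toReal w ν * baseKer (fineHessGhQ n a x₀ cK 0 μ ν) b w)))
      + rowDefect n (fineHessGhQ n a x₀ cK 0) μ ν := by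
  have hn : (0 : ℝ) < 1 / (n : ℝ) := div_pos one_pos (by exact_mod_cast Nat.pos_of_ne_zero (NeZero.ne n))
  rw [PghQ_eq, fineHessGhQ_eq]
  exact secondMoment_TOfGh_eq_avg_fullSum_add_rowDefect n a ha (biLoc_SghAt_ctr n cK 0) (biLoc_WghAt_ctr n x₀ cK 0) hn
    (fun κ' u v => SghAt_cQ_zero_translate n (ctrHalf n) cK κ' u v) (fun κ' u l' u' v => WghAt_cQ_zero_translate n (ctrHalf n) x₀ cK κ' u l' u' v) μ ν

end Pinned

/-! ## §2 The (1.22)-moment of the pinned-minus-ray difference and of `ΔGH` -/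

section Delta

variable (n : ℕ) [NeZero n] (a : ℝ)

/-- [folklore] **THE (1.22)-MOMENT OF «PINNED MINUS RAY»** (`Odd n`, `0 < a`; every `c x₀ cK`): for the pointwise difference of the pinned ghost kernel
`PghQ n a x₀ cK 0` and the ray kernel `PghQ n a (−c) (c·n²) (c·a)`,
`secondMoment (pinned − ray) μ ν = Σ_b n⁻⁴·fullSum (w ↦ n⁻⁸·w_μw_ν·(baseKer (fineHessGhQ n a x₀ cK 0 μ ν) b w − baseKer (fineHessGhQ n a (−c) (c·n²) (c·a) μ ν) b w)) + rowDefect n (fineHessGhQ n a x₀ cK 0) μ ν`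
— §1 for the pinned kernel, the owner's `AssemblySlots.hF_PghQ_ray` (no defect: Ward rows a theorem on the ray) for the ray kernel, linearity of the
(1.22) sum (`RestKernelWords.summable_moment_term` at `absMoment₂_PghQ`, `tsum_sub`) and of the punctured full sums (`Assembly.fullSum_sub'`,
convergence from `absMoment₂_baseKer_fineHessGhQ`).  The cells term is NOT split into words here. -/
theorem secondMoment_PghQ_cQ_zero_sub_ray_eq (hodd : Odd n) (ha : 0 < a) (c x₀ cK : ℝ) (μ ν : Fin 4) :
    B12Beta.secondMoment (fun μ' ν' z => PghQ n a x₀ cK 0 μ' ν' z - PghQ n a (-c) (c * (n : ℝ) ^ 2) (c * a) μ' ν' z) μ ν =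
      (∑ b ∈ (univ : Finset (Fin 4 → Fin n)).image resSite, ((n : ℝ) ^ 4)⁻¹ *
        fullSum (fun w : Pt => ((n : ℝ) ^ 8)⁻¹ * (toReal w μ * toReal w ν *
          (baseKer (fineHessGhQ n a x₀ cK 0 μ ν) b w - baseKer (fineHessGhQ n a (-c) (c * (n : ℝ) ^ 2) (c * a) μ ν) b w))))
      + rowDefect n (fineHessGhQ n a x₀ cK 0) μ ν := by
  -- the (1.22) sum of the pointwise difference is the difference of the (1.22) sums (both absolutely summable)
  have hsub : B12Beta.secondMoment (fun μ' ν' z => PghQ n a x₀ cK 0 μ' ν' z - PghQ n a (-c) (c * (n : ℝ) ^ 2) (c * a) μ' ν' z) μ ν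
      = B12Beta.secondMoment (PghQ n a x₀ cK 0) μ ν - B12Beta.secondMoment (PghQ n a (-c) (c * (n : ℝ) ^ 2) (c * a)) μ ν := by
    unfold B12Beta.secondMoment
    rw [← (summable_moment_term (absMoment₂_PghQ n a x₀ cK 0 ha μ ν) μ ν).tsum_sub
      (summable_moment_term (absMoment₂_PghQ n a (-c) (c * (n : ℝ) ^ 2) (c * a) ha μ ν) μ ν)]
    exact tsum_congr fun z => by ring
  rw [hsub, secondMoment_PghQ_cQ_zero_eq n a ha x₀ cK μ ν, hF_PghQ_ray n a hodd ha c μ ν]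
  -- the cells: `Σ_b n⁻⁴·fullSum f₁ − Σ_b n⁻⁴·fullSum f₂ = Σ_b n⁻⁴·fullSum (f₁ − f₂)`
  have hcell : ∀ b : Site 4,
      fullSum (fun w : Pt => ((n : ℝ) ^ 8)⁻¹ * (toReal w μ * toReal w ν *
          (baseKer (fineHessGhQ n a x₀ cK 0 μ ν) b w - baseKer (fineHessGhQ n a (-c) (c * (n : ℝ) ^ 2) (c * a) μ ν) b w)))
        = fullSum (fun w : Pt => ((n : ℝ) ^ 8)⁻¹ * (toReal w μ * toReal w ν * baseKer (fineHessGhQ n a x₀ cK 0 μ ν) b w))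
          - fullSum (fun w : Pt => ((n : ℝ) ^ 8)⁻¹ *
              (toReal w μ * toReal w ν * baseKer (fineHessGhQ n a (-c) (c * (n : ℝ) ^ 2) (c * a) μ ν) b w)) := by
    intro b
    rw [← fullSum_sub' (exists_tendsto_psum_const_mul _ (exists_tendsto_psum_weight_mul (absMoment₂_baseKer_fineHessGhQ n a x₀ cK 0 ha μ ν b) μ ν))
      (exists_tendsto_psum_const_mul _
        (exists_tendsto_psum_weight_mul (absMoment₂_baseKer_fineHessGhQ n a (-c) (c * (n : ℝ) ^ 2) (c * a) ha μ ν b) μ ν))]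
    exact congrArg fullSum (funext fun w => by ring)
  simp only [hcell]
  simp only [mul_sub, sum_sub_distrib]
  ring

/-- [our object] **THE (1.22)-MOMENT OF `ΔGH` — THE INSTANCE OF RECORD** (ρ-g15-4: pins `(x₀, cK, cQ) = (−1, n², 0)` of (S-GH), ray `c = 1`, weight `2`):
with `ΔGH μ ν z := 2·(PghQ n a (−1) n² 0 μ ν z − PghQ n a (−1) n² a μ ν z)`,
`secondMoment ΔGH μ ν = 2·Σ_b n⁻⁴·fullSum (w ↦ n⁻⁸·w_μw_ν·(baseKer (fineHessGhQ n a (−1) n² 0 μ ν) b w − baseKer (fineHessGhQ n a (−1) n² a μ ν) b w)) + 2·rowDefect n (fineHessGhQ n a (−1) n² 0) μ ν`.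
READING: the cells term is minus the cQ-sector cells of the ray kernel (NOT split into words here); the defect row
`rowDefect n (fineHessGhQ n a (−1) n² 0)` is NOT claimed to be bounded.  NOT on the (K) row's path after owner ruling ρ-g16-2 («ΔGH DIRECT»: the
member's `hRu` row is a direct envelope with `Ru := 0`, leaf-04's FILE 5); kept as the cells∕defect reading of F-d1leaf01-g20-3. -/
theorem secondMoment_deltaGH_eq (hodd : Odd n) (ha : 0 < a) (μ ν : Fin 4) :
    B12Beta.secondMoment (fun μ' ν' z => 2 * (PghQ n a (-1) (((n : ℝ) ^ 2)) 0 μ' ν' z - PghQ n a (-1) (((n : ℝ) ^ 2)) a μ' ν' z)) μ ν =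
      2 * (∑ b ∈ (univ : Finset (Fin 4 → Fin n)).image resSite, ((n : ℝ) ^ 4)⁻¹ *
        fullSum (fun w : Pt => ((n : ℝ) ^ 8)⁻¹ * (toReal w μ * toReal w ν *
          (baseKer (fineHessGhQ n a (-1) (((n : ℝ) ^ 2)) 0 μ ν) b w - baseKer (fineHessGhQ n a (-1) (((n : ℝ) ^ 2)) a μ ν) b w))))
      + 2 * rowDefect n (fineHessGhQ n a (-1) (((n : ℝ) ^ 2)) 0) μ ν := by
  have h := secondMoment_PghQ_cQ_zero_sub_ray_eq n a hodd ha 1 (-1) (((n : ℝ) ^ 2)) μ ν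
  simp only [one_mul] at h
  have h2 : B12Beta.secondMoment (fun μ' ν' z => 2 * (PghQ n a (-1) (((n : ℝ) ^ 2)) 0 μ' ν' z - PghQ n a (-1) (((n : ℝ) ^ 2)) a μ' ν' z)) μ ν
      = 2 * B12Beta.secondMoment (fun μ' ν' z => PghQ n a (-1) (((n : ℝ) ^ 2)) 0 μ' ν' z - PghQ n a (-1) (((n : ℝ) ^ 2)) a μ' ν' z) μ ν := by
    unfold B12Beta.secondMoment
    rw [← tsum_mul_left]
    exact tsum_congr fun z => by ring
  rw [h2, h, mul_add]

end Delta

/-! ## §3 The rest member `uΔGH`: its `hMR` row -/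

section Member

variable (n : ℕ) [NeZero n] (a : ℝ)

omit [NeZero n] in
/-- [folklore] Absolute second moments are stable under `z ↦ c·(f z − g z)`. -/
theorem absMoment₂_const_mul_sub {f g : Site 4 → ℝ} (hf : AbsMoment₂ f) (hg : AbsMoment₂ g) (c : ℝ) :
    AbsMoment₂ (fun z => c * (f z - g z)) := by
  unfold AbsMoment₂ at hf hg ⊢
  refine Summable.of_nonneg_of_le (fun z => by positivity) (fun z => ?_) ((hf.add hg).mul_left |c|)
  rw [abs_mul]
  have h1 : 0 ≤ 1 + l1 z ^ 2 := by positivity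
  calc (1 + l1 z ^ 2) * (|c| * |f z - g z|) = |c| * ((1 + l1 z ^ 2) * |f z - g z|) := by ring
    _ ≤ |c| * ((1 + l1 z ^ 2) * |f z| + (1 + l1 z ^ 2) * |g z|) := by
        refine mul_le_mul_of_nonneg_left ?_ (abs_nonneg c)
        rw [← mul_add]
        exact mul_le_mul_of_nonneg_left (abs_sub _ _) h1

/-- [our object] **THE `hMR` ROW OF THE REST MEMBER `uΔGH`** (owner ruling ρ-g16-2 (2): kernel `ω·ΔGH` at any weight `ω` — the END's `ωgh n`, sign per
(S-A1)): `z ↦ ω·(2·(PghQ n a (−1) n² 0 μ ν z − PghQ n a (−1) n² a μ ν z))` has absolutely summable second moments (`absMoment₂_PghQ` ×2; `0 < a`).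
Its `hRu` row (`Ru := 0`, direct n-uniform envelope `CU′`) is leaf-04's «RK-GH-UNIT» FILE 5, NOT here. -/
theorem absMoment₂_deltaGH (ha : 0 < a) (ω : ℝ) (μ ν : Fin 4) :
    AbsMoment₂ (fun z => ω * (2 * (PghQ n a (-1) (((n : ℝ) ^ 2)) 0 μ ν z - PghQ n a (-1) (((n : ℝ) ^ 2)) a μ ν z))) := by
  have h := absMoment₂_const_mul_sub (absMoment₂_PghQ n a (-1) (((n : ℝ) ^ 2)) 0 ha μ ν)
    (absMoment₂_PghQ n a (-1) (((n : ℝ) ^ 2)) a ha μ ν) (ω * 2)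
  refine (show (fun z => ω * (2 * (PghQ n a (-1) (((n : ℝ) ^ 2)) 0 μ ν z - PghQ n a (-1) (((n : ℝ) ^ 2)) a μ ν z)))
      = fun z => ω * 2 * (PghQ n a (-1) (((n : ℝ) ^ 2)) 0 μ ν z - PghQ n a (-1) (((n : ℝ) ^ 2)) a μ ν z) from
    funext fun z => by ring) ▸ h

end Member

end Summit.QuantumFields.BalabanUV.Beta.D1BFx.GhostPinnedTransfer

end
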